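import Literature.Probability.RandomPlanarGeometry.HexSAWPolygonHorizontalCut
import HarnessLib

/-!
# Decoding the horizontal double-brick join on the honeycomb lattice, shapes TF / FT / TT

Topic `Literature/Probability/RandomPlanarGeometry` (lane «pcv-sawmu», a-p4 g14; sequel of TREE `HexSAWPolygonHorizontalCut.lean` (shape FF:
`IsHdCut`, `isHdCut_unique`, `not_isHdCut'_of_isHdCut`, and the generic two-arc device `sep_contra`)).

Context.  In the capless Madras join on the brick wall `ℍ` (N. Madras, J. Stat. Phys. 78 (1995) §2; A. Hammond, arXiv:1504.05286v5 §4.1,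
Definition 4.3 p. 20) a first touch at horizontal distance `2` with the right polygon one row up is merged across a HORIZONTAL DOUBLE BRICK
(contact type T3 of `HexSAWPolygonJunctions.hdJoin`; contact site `t` of `P`, facing site `w′ = t + (2,1)` of `Q`, `c = t + (3,1)`, `b = t − (1,0)`).
Besides the basic shape FF there are three more shapes, according to the two bits `t + (−1,1) ∈ P` (then `b` has both of its `P`-bonds on the
cluster boundary and drops out of the joined polygon, which passes `… → t+(0,1) → t+(−1,1) → (P-arc) → t → …`) and `t + (3,0) ∈ Q` (then `c`
drops out and the joined polygon passes `… → t+(2,0) → t+(3,0) → (Q-arc) → w′ → …`).  For each shape X ∈ {TF, FT, TT} this file records the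
forward cut predicate `IsHdCutX M v j` (left block `v[j, j+M)` strictly left of the right block `v[j+M, j+2M)` in every row, the connector sites at
their fixed offsets from the base `v j`) and the backward one `IsHdCutX'` (the same polygon read in the opposite direction, based at the site
after the forward base), and proves, exactly as for FF: **the forward cut is unique** (`isHdCutX_unique`) and **forward and backward cuts never
coexist** (`not_isHdCutX'_of_isHdCutX`).  Every proof is the two-arc device `sep_contra` of the FF file (two index arcs whose row ranges share a
value carry a same-row pair, which the two separations order oppositely) plus a handful of degenerate positions settled by the connector columns.

## What is proved (namespace `…SAW.HexBW`; all `theorem`s, axioms standard)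
* `IsHdCutTF/TF'`, `IsHdCutFT/FT'`, `IsHdCutTT/TT'` with `_shift` / `_add_period`;
* `not_isHdCutX_of_zero`, **`isHdCutX_unique`**, `not_isHdCutX'_of_isHdCutX_zero`, **`not_isHdCutX'_of_isHdCutX`** for X = TF, FT, TT.
[cite: Hammond2015SAPJoining, Definition 4.3 and §4.2 (arXiv v5 pp. 20–24: junction plaquette; global join plaquettes)]
[cite: Madras1995LatticeAnimalsExponent, §2 (primary, not held by the lane)] [cite: MadrasSlade1993, Theorem 3.2.3 proof (pp. 64–65: decoding a
polygon concatenation)].  Label (expected): NEW-IN-WRITING (modest), technique class Madras join; companion of the FF file.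
-/

noncomputable section

open Literature.Probability.LatticeModels

namespace Literature.Probability.RandomPlanarGeometry.SAW

namespace HexBW

variable {M : ℕ} {v : ℕ → Site 2}

/-! ### Shape TF: shape TF (`t + (−1,1) ∈ P`, `t + (3,0) ∉ Q`; `M = |P| + 2`) -/

/-- **Horizontal cut, forward reading**, shape TF (`t + (−1,1) ∈ P`, `t + (3,0) ∉ Q`; `M = |P| + 2`), of a `2M`-periodic site sequence at `j`,
base `s = v j = t + (−1,1)` (the first site of the left block; `t − (1,0)` is not on the joined polygon): the left block `v[j, j+M)` is `s,
(P-arc), t = s+(1,−1), s+(2,−1), s+(3,−1), s+(4,−1)`, the right block `v[j+M, j+2M)` is `c = s+(4,0), (Q-arc), w′ = s+(3,0), s+(2,0), s+(1,0)`;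
the left block lies strictly left of the right block in every row. [cite: Hammond2015SAPJoining, Definition 4.3 (arXiv v5 p. 20: the junction
plaquette; here a horizontal two-brick cluster)] -/
def IsHdCutTF (M : ℕ) (v : ℕ → Site 2) (j : ℕ) : Prop :=
  (v (j + M - 4) 0 = v j 0 + 1 ∧ v (j + M - 4) 1 + 1 = v j 1) ∧
  (v (j + M - 3) 0 = v j 0 + 2 ∧ v (j + M - 3) 1 + 1 = v j 1) ∧
  (v (j + M - 2) 0 = v j 0 + 3 ∧ v (j + M - 2) 1 + 1 = v j 1) ∧
  (v (j + M - 1) 0 = v j 0 + 4 ∧ v (j + M - 1) 1 + 1 = v j 1) ∧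
  (v (j + M) 0 = v j 0 + 4 ∧ v (j + M) 1 = v j 1) ∧
  (v (j + 2 * M - 3) 0 = v j 0 + 3 ∧ v (j + 2 * M - 3) 1 = v j 1) ∧
  (v (j + 2 * M - 2) 0 = v j 0 + 2 ∧ v (j + 2 * M - 2) 1 = v j 1) ∧
  (v (j + 2 * M - 1) 0 = v j 0 + 1 ∧ v (j + 2 * M - 1) 1 = v j 1) ∧
  ∀ a b : ℕ, j ≤ a → a < j + M → j + M ≤ b → b < j + 2 * M → v a 1 = v b 1 → v a 0 < v b 0

/-- **Horizontal cut, backward reading**, shape TF (`t + (−1,1) ∈ P`, `t + (3,0) ∉ Q`; `M = |P| + 2`), at `j`, base `r = v j = t + (0,1)`: the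
first block `v[j, j+M)` is `r, r+(1,0), w′ = r+(2,0), (Q-arc), c = r+(3,0)`, the second block `v[j+M, j+2M)` is `r+(3,−1), r+(2,−1), r+(1,−1), t =
r+(0,−1), (P-arc), r+(−1,0)`; the FIRST block lies strictly RIGHT of the second in every row. [cite: Hammond2015SAPJoining, Definition 4.3 (arXiv
v5 p. 20)] -/
def IsHdCutTF' (M : ℕ) (v : ℕ → Site 2) (j : ℕ) : Prop :=
  (v (j + 1) 0 = v j 0 + 1 ∧ v (j + 1) 1 = v j 1) ∧
  (v (j + 2) 0 = v j 0 + 2 ∧ v (j + 2) 1 = v j 1) ∧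
  (v (j + M - 1) 0 = v j 0 + 3 ∧ v (j + M - 1) 1 = v j 1) ∧
  (v (j + M) 0 = v j 0 + 3 ∧ v (j + M) 1 + 1 = v j 1) ∧
  (v (j + M + 1) 0 = v j 0 + 2 ∧ v (j + M + 1) 1 + 1 = v j 1) ∧
  (v (j + M + 2) 0 = v j 0 + 1 ∧ v (j + M + 2) 1 + 1 = v j 1) ∧
  (v (j + M + 3) 0 = v j 0 ∧ v (j + M + 3) 1 + 1 = v j 1) ∧
  (v (j + 2 * M - 1) 0 + 1 = v j 0 ∧ v (j + 2 * M - 1) 1 = v j 1) ∧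
  ∀ a b : ℕ, j ≤ a → a < j + M → j + M ≤ b → b < j + 2 * M → v a 1 = v b 1 → v b 0 < v a 0

/-! #### Symmetries (TF) -/

/-- Re-indexing: a cut of `v` at `c + j` is a cut of `v (· + c)` at `j`. [cite: Hammond2015SAPJoining, Definition 4.3 (arXiv v5 p. 20)] -/
theorem isHdCutTF_shift {c j : ℕ} (hM : 5 ≤ M) (h : IsHdCutTF M v (c + j)) : IsHdCutTF M (fun i => v (i + c)) j := by
  obtain ⟨⟨a0, a1⟩, ⟨b0, b1⟩, ⟨c0, c1⟩, ⟨d0, d1⟩, ⟨e0, e1⟩, ⟨f0, f1⟩, ⟨g0, g1⟩, ⟨h0, h1⟩, sep⟩ := h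
  have E : ∀ k l : ℕ, l = c + k → v (k + c) = v l := fun k l hl => by rw [hl, Nat.add_comm]
  rw [IsHdCutTF, E (j + M - 4) (c + j + M - 4) (by omega), E (j + M - 3) (c + j + M - 3) (by omega), E (j + M - 2) (c + j + M - 2) (by omega),
    E (j + M - 1) (c + j + M - 1) (by omega), E (j + M) (c + j + M) (by omega), E (j + 2 * M - 3) (c + j + 2 * M - 3) (by omega),
    E (j + 2 * M - 2) (c + j + 2 * M - 2) (by omega), E (j + 2 * M - 1) (c + j + 2 * M - 1) (by omega), E j (c + j) rfl]
  refine ⟨⟨a0, a1⟩, ⟨b0, b1⟩, ⟨c0, c1⟩, ⟨d0, d1⟩, ⟨e0, e1⟩, ⟨f0, f1⟩, ⟨g0, g1⟩, ⟨h0, h1⟩, fun a b ha1 ha2 hb1 hb2 hr => ?_⟩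
  exact sep (a + c) (b + c) (by omega) (by omega) (by omega) (by omega) hr

/-- Periodicity: a cut at `j` is a cut at `j + 2M`. [cite: Hammond2015SAPJoining, Definition 4.3 (arXiv v5 p. 20)] -/
theorem isHdCutTF_add_period {j : ℕ} (hM : 5 ≤ M) (hper : ∀ i, v (i + 2 * M) = v i) (h : IsHdCutTF M v j) :
    IsHdCutTF M v (j + 2 * M) := by
  obtain ⟨⟨a0, a1⟩, ⟨b0, b1⟩, ⟨c0, c1⟩, ⟨d0, d1⟩, ⟨e0, e1⟩, ⟨f0, f1⟩, ⟨g0, g1⟩, ⟨h0, h1⟩, sep⟩ := h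
  have E : ∀ i k : ℕ, k = i + 2 * M → v k = v i := fun i k hk => by rw [hk, hper]
  rw [IsHdCutTF, E (j + M - 4) (j + 2 * M + M - 4) (by omega), E (j + M - 3) (j + 2 * M + M - 3) (by omega), E (j + M - 2) (j + 2 * M + M - 2) (by omega),
    E (j + M - 1) (j + 2 * M + M - 1) (by omega), E (j + M) (j + 2 * M + M) (by omega), E (j + 2 * M - 3) (j + 2 * M + 2 * M - 3) (by omega),
    E (j + 2 * M - 2) (j + 2 * M + 2 * M - 2) (by omega), E (j + 2 * M - 1) (j + 2 * M + 2 * M - 1) (by omega), E j (j + 2 * M) rfl]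
  refine ⟨⟨a0, a1⟩, ⟨b0, b1⟩, ⟨c0, c1⟩, ⟨d0, d1⟩, ⟨e0, e1⟩, ⟨f0, f1⟩, ⟨g0, g1⟩, ⟨h0, h1⟩, fun a b ha1 ha2 hb1 hb2 hr => ?_⟩
  have ha := E (a - 2 * M) a (by omega)
  have hb := E (b - 2 * M) b (by omega)
  rw [ha, hb] at hr ⊢
  exact sep _ _ (by omega) (by omega) (by omega) (by omega) hr

/-- Re-indexing: a cut of `v` at `c + j` is a cut of `v (· + c)` at `j`. [cite: Hammond2015SAPJoining, Definition 4.3 (arXiv v5 p. 20)] -/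
theorem isHdCutTF'_shift {c j : ℕ} (hM : 5 ≤ M) (h : IsHdCutTF' M v (c + j)) : IsHdCutTF' M (fun i => v (i + c)) j := by
  obtain ⟨⟨a0, a1⟩, ⟨b0, b1⟩, ⟨c0, c1⟩, ⟨d0, d1⟩, ⟨e0, e1⟩, ⟨f0, f1⟩, ⟨g0, g1⟩, ⟨h0, h1⟩, sep⟩ := h
  have E : ∀ k l : ℕ, l = c + k → v (k + c) = v l := fun k l hl => by rw [hl, Nat.add_comm]
  rw [IsHdCutTF', E (j + 1) (c + j + 1) (by omega), E (j + 2) (c + j + 2) (by omega), E (j + M - 1) (c + j + M - 1) (by omega),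
    E (j + M) (c + j + M) (by omega), E (j + M + 1) (c + j + M + 1) (by omega), E (j + M + 2) (c + j + M + 2) (by omega),
    E (j + M + 3) (c + j + M + 3) (by omega), E (j + 2 * M - 1) (c + j + 2 * M - 1) (by omega), E j (c + j) rfl]
  refine ⟨⟨a0, a1⟩, ⟨b0, b1⟩, ⟨c0, c1⟩, ⟨d0, d1⟩, ⟨e0, e1⟩, ⟨f0, f1⟩, ⟨g0, g1⟩, ⟨h0, h1⟩, fun a b ha1 ha2 hb1 hb2 hr => ?_⟩
  exact sep (a + c) (b + c) (by omega) (by omega) (by omega) (by omega) hr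

/-- Periodicity: a cut at `j` is a cut at `j + 2M`. [cite: Hammond2015SAPJoining, Definition 4.3 (arXiv v5 p. 20)] -/
theorem isHdCutTF'_add_period {j : ℕ} (hM : 5 ≤ M) (hper : ∀ i, v (i + 2 * M) = v i) (h : IsHdCutTF' M v j) :
    IsHdCutTF' M v (j + 2 * M) := by
  obtain ⟨⟨a0, a1⟩, ⟨b0, b1⟩, ⟨c0, c1⟩, ⟨d0, d1⟩, ⟨e0, e1⟩, ⟨f0, f1⟩, ⟨g0, g1⟩, ⟨h0, h1⟩, sep⟩ := h
  have E : ∀ i k : ℕ, k = i + 2 * M → v k = v i := fun i k hk => by rw [hk, hper]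
  rw [IsHdCutTF', E (j + 1) (j + 2 * M + 1) (by omega), E (j + 2) (j + 2 * M + 2) (by omega), E (j + M - 1) (j + 2 * M + M - 1) (by omega),
    E (j + M) (j + 2 * M + M) (by omega), E (j + M + 1) (j + 2 * M + M + 1) (by omega), E (j + M + 2) (j + 2 * M + M + 2) (by omega),
    E (j + M + 3) (j + 2 * M + M + 3) (by omega), E (j + 2 * M - 1) (j + 2 * M + 2 * M - 1) (by omega), E j (j + 2 * M) rfl]
  refine ⟨⟨a0, a1⟩, ⟨b0, b1⟩, ⟨c0, c1⟩, ⟨d0, d1⟩, ⟨e0, e1⟩, ⟨f0, f1⟩, ⟨g0, g1⟩, ⟨h0, h1⟩, fun a b ha1 ha2 hb1 hb2 hr => ?_⟩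
  have ha := E (a - 2 * M) a (by omega)
  have hb := E (b - 2 * M) b (by omega)
  rw [ha, hb] at hr ⊢
  exact sep _ _ (by omega) (by omega) (by omega) (by omega) hr

/-! #### Uniqueness of the forward cut (TF) -/

/-- Core case (TF): a forward cut at `0` excludes a forward cut at any `1 ≤ j ≤ M`. [cite: Hammond2015SAPJoining, §4.2 (arXiv v5 pp. 20–24: global
join plaquettes; here unique, for row-separated joins)] -/
theorem not_isHdCutTF_of_zero (hM : 5 ≤ M) (hper : ∀ i, v (i + 2 * M) = v i)
    (hrow : ∀ i, v (i + 1) 1 ≤ v i 1 + 1 ∧ v i 1 ≤ v (i + 1) 1 + 1) (hz : IsHdCutTF M v 0) {j : ℕ} (hone : 1 ≤ j) (hle : j ≤ M)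
    (hj : IsHdCutTF M v j) : False := by
  obtain ⟨⟨a0, a1⟩, ⟨b0, b1⟩, ⟨c0, c1⟩, ⟨d0, d1⟩, ⟨e0, e1⟩, ⟨f0, f1⟩, ⟨g0, g1⟩, ⟨h0, h1⟩, sep0⟩ := hz
  obtain ⟨⟨aj0, aj1⟩, ⟨bj0, bj1⟩, ⟨cj0, cj1⟩, ⟨dj0, dj1⟩, ⟨ej0, ej1⟩, ⟨fj0, fj1⟩, ⟨gj0, gj1⟩, ⟨hj0, hj1⟩, sepj⟩ := hj
  simp only [Nat.zero_add] at a0 a1 b0 b1 c0 c1 d0 d1 e0 e1 f0 f1 g0 g1 h0 h1 sep0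
  by_cases hjM : j = M
  · subst hjM
    rw [show j + j - 1 = 2 * j - 1 by omega] at dj0
    omega
  -- `1 ≤ j ≤ M − 1`: the arcs `A = [0, j−1] ⊆ L₀ ∩ R_j` and `B = [M, M+j−1] ⊆ R₀ ∩ L_j` both start in the base row
  exact sep_contra hrow (a₁ := 0) (a₂ := j - 1) (b₁ := M) (b₂ := M + j - 1) (by omega) (by omega) (v 0 1) (by omega) (by omega)
    (fun a b _ ha2 hb1 hb2 hr => sep0 a b (Nat.zero_le _) (by omega) hb1 (by omega) hr)
    (fun a b _ ha2 hb1 hb2 hr => by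
      have := sepj b (a + 2 * M) (by omega) (by omega) (by omega) (by omega) (by rw [hper]; exact hr.symm)
      rwa [hper] at this)

/-- **The forward horizontal cut of a merged honeycomb polygon is unique** (shape TF (`t + (−1,1) ∈ P`, `t + (3,0) ∉ Q`; `M = |P| + 2`)): for a
`2M`-periodic site sequence whose
rows move by at most one per step, two forward cuts `j₁, j₂ < 2M` coincide. [cite: Hammond2015SAPJoining, Definition 4.3 and §4.2 (arXiv v5 pp. 20–24)] [cite: Madras1995LatticeAnimalsExponent, §2] [cite: MadrasSlade1993, Theorem 3.2.3 proof (pp. 64–65)] -/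
theorem isHdCutTF_unique (hM : 5 ≤ M) (hper : ∀ i, v (i + 2 * M) = v i)
    (hrow : ∀ i, v (i + 1) 1 ≤ v i 1 + 1 ∧ v i 1 ≤ v (i + 1) 1 + 1) {j₁ j₂ : ℕ} (hj₁ : j₁ < 2 * M) (hj₂ : j₂ < 2 * M)
    (h₁ : IsHdCutTF M v j₁) (h₂ : IsHdCutTF M v j₂) : j₁ = j₂ := by
  by_contra hne
  have shift : ∀ a, (∀ i, (fun i => v (i + a)) (i + 2 * M) = (fun i => v (i + a)) i) ∧
      (∀ i, (fun i => v (i + a)) (i + 1) 1 ≤ (fun i => v (i + a)) i 1 + 1 ∧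
        (fun i => v (i + a)) i 1 ≤ (fun i => v (i + a)) (i + 1) 1 + 1) := by
    intro a
    refine ⟨fun i => ?_, fun i => ?_⟩
    · show v (i + 2 * M + a) = v (i + a)
      rw [show i + 2 * M + a = (i + a) + 2 * M by omega, hper]
    · show v (i + 1 + a) 1 ≤ v (i + a) 1 + 1 ∧ v (i + a) 1 ≤ v (i + 1 + a) 1 + 1
      rw [show i + 1 + a = (i + a) + 1 by omega]; exact hrow _
  have key : ∀ {a b : ℕ}, a < b → b ≤ a + M → IsHdCutTF M v a → IsHdCutTF M v b → False := by
    intro a b hab hbM ha hb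
    obtain ⟨hper', hrow'⟩ := shift a
    have h0 : IsHdCutTF M (fun i => v (i + a)) 0 := isHdCutTF_shift hM (by simpa using ha)
    have hb' : IsHdCutTF M (fun i => v (i + a)) (b - a) := isHdCutTF_shift hM (by rw [Nat.add_sub_cancel' hab.le]; exact hb)
    exact not_isHdCutTF_of_zero hM hper' hrow' h0 (by omega) (by omega) hb'
  rcases Nat.lt_or_gt_of_ne hne with h | h
  · by_cases hd : j₂ ≤ j₁ + M
    · exact key h hd h₁ h₂
    · exact key (show j₂ < j₁ + 2 * M by omega) (by omega) h₂ (isHdCutTF_add_period hM hper h₁)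
  · by_cases hd : j₁ ≤ j₂ + M
    · exact key h hd h₂ h₁
    · exact key (show j₁ < j₂ + 2 * M by omega) (by omega) h₁ (isHdCutTF_add_period hM hper h₂)

/-! #### No backward cut next to a forward cut (TF) -/

/-- Core case (TF): a forward cut at `0` excludes a backward cut at any `j < 2M`. [cite: Hammond2015SAPJoining, §4.2 (arXiv v5 pp. 20–24: global
join plaquettes; here unique, for row-separated joins)] -/
theorem not_isHdCutTF'_of_isHdCutTF_zero (hM : 5 ≤ M) (hper : ∀ i, v (i + 2 * M) = v i)
    (hrow : ∀ i, v (i + 1) 1 ≤ v i 1 + 1 ∧ v i 1 ≤ v (i + 1) 1 + 1) (hz : IsHdCutTF M v 0) {j : ℕ} (hj2 : j < 2 * M)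
    (hj : IsHdCutTF' M v j) : False := by
  obtain ⟨⟨a0, a1⟩, ⟨b0, b1⟩, ⟨c0, c1⟩, ⟨d0, d1⟩, ⟨e0, e1⟩, ⟨f0, f1⟩, ⟨g0, g1⟩, ⟨h0, h1⟩, sep0⟩ := hz
  obtain ⟨⟨aj0, aj1⟩, ⟨bj0, bj1⟩, ⟨cj0, cj1⟩, ⟨dj0, dj1⟩, ⟨ej0, ej1⟩, ⟨fj0, fj1⟩, ⟨gj0, gj1⟩, ⟨hj0, hj1⟩, sepj⟩ := hj
  simp only [Nat.zero_add] at a0 a1 b0 b1 c0 c1 d0 d1 e0 e1 f0 f1 g0 g1 h0 h1 sep0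
  rcases Nat.lt_or_ge j M with hlt | hge
  · -- `j ≤ M − 1`: the arcs `X = [j, M−1] ⊆ L₀ ∩ F_j` and `Y = [j+M, 2M−1] ⊆ R₀ ∩ S_j` overlap in rows
    have key : ∀ r : ℤ, ((v j 1 ≤ r ∧ r ≤ v (M - 1) 1) ∨ (v (M - 1) 1 ≤ r ∧ r ≤ v j 1)) →
        ((v (j + M) 1 ≤ r ∧ r ≤ v (2 * M - 1) 1) ∨ (v (2 * M - 1) 1 ≤ r ∧ r ≤ v (j + M) 1)) → False := fun r hrA hrB =>
      sep_contra hrow (a₁ := j) (a₂ := M - 1) (b₁ := j + M) (b₂ := 2 * M - 1) (by omega) (by omega) r hrA hrB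
        (fun a b ha1 ha2 hb1 hb2 hr => sep0 a b (Nat.zero_le _) (by omega) (by omega) (by omega) hr)
        (fun a b ha1 ha2 hb1 hb2 hr => sepj a b ha1 (by omega) hb1 (by omega) hr)
    by_cases hy : v j 1 ≤ v 0 1
    · exact key (v j 1) (by omega) (by omega)
    · exact key (v 0 1) (by omega) (by omega)
  by_cases e0 : j = M
  · subst e0
    rw [show j + j - 1 = 2 * j - 1 by omega] at cj0
    omega
  -- `j = M + k`, `1 ≤ k ≤ M − 1`: the arcs `A = [0, k−1]` and `B = [M, M+k−1]` both start in the base row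
  obtain ⟨k, rfl⟩ : ∃ k, j = M + k := ⟨j - M, by omega⟩
  have hk1 : 1 ≤ k := by omega
  have hkM : k ≤ M - 1 := by omega
  exact sep_contra hrow (a₁ := 0) (a₂ := k - 1) (b₁ := M) (b₂ := M + k - 1) (by omega) (by omega) (v 0 1) (by omega) (by omega)
    (fun a b _ ha2 hb1 hb2 hr => sep0 a b (Nat.zero_le _) (by omega) hb1 (by omega) hr)
    (fun a b _ ha2 hb1 hb2 hr => by
      have := sepj (a + 2 * M) (b + 2 * M) (by omega) (by omega) (by omega) (by omega) (by rw [hper, hper]; exact hr)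
      rwa [hper, hper] at this)

/-- **A forward and a backward horizontal cut never coexist** (shape TF (`t + (−1,1) ∈ P`, `t + (3,0) ∉ Q`; `M = |P| + 2`); `j₁, j₂ < 2M`). [cite:
Hammond2015SAPJoining, Definition 4.3 and §4.2 (arXiv v5 pp. 20–24)] [cite: Madras1995LatticeAnimalsExponent, §2] [cite: MadrasSlade1993, Theorem
3.2.3 proof (pp. 64–65)] -/
theorem not_isHdCutTF'_of_isHdCutTF (hM : 5 ≤ M) (hper : ∀ i, v (i + 2 * M) = v i)
    (hrow : ∀ i, v (i + 1) 1 ≤ v i 1 + 1 ∧ v i 1 ≤ v (i + 1) 1 + 1) {j₁ j₂ : ℕ} (hj₁ : j₁ < 2 * M) (hj₂ : j₂ < 2 * M)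
    (h₁ : IsHdCutTF M v j₁) (h₂ : IsHdCutTF' M v j₂) : False := by
  have hper' : ∀ i, (fun i => v (i + j₁)) (i + 2 * M) = (fun i => v (i + j₁)) i := fun i => by
    show v (i + 2 * M + j₁) = v (i + j₁)
    rw [show i + 2 * M + j₁ = (i + j₁) + 2 * M by omega, hper]
  have hrow' : ∀ i, (fun i => v (i + j₁)) (i + 1) 1 ≤ (fun i => v (i + j₁)) i 1 + 1 ∧
      (fun i => v (i + j₁)) i 1 ≤ (fun i => v (i + j₁)) (i + 1) 1 + 1 := fun i => by
    show v (i + 1 + j₁) 1 ≤ v (i + j₁) 1 + 1 ∧ v (i + j₁) 1 ≤ v (i + 1 + j₁) 1 + 1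
    rw [show i + 1 + j₁ = (i + j₁) + 1 by omega]; exact hrow _
  have h0 : IsHdCutTF M (fun i => v (i + j₁)) 0 := isHdCutTF_shift hM (by simpa using h₁)
  rcases Nat.lt_or_ge j₂ j₁ with hlt | hge
  · have h₂' := isHdCutTF'_add_period hM hper h₂
    have hb : IsHdCutTF' M (fun i => v (i + j₁)) (j₂ + 2 * M - j₁) :=
      isHdCutTF'_shift hM (by rw [show j₁ + (j₂ + 2 * M - j₁) = j₂ + 2 * M by omega]; exact h₂')
    exact not_isHdCutTF'_of_isHdCutTF_zero hM hper' hrow' h0 (by omega) hb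
  · have hb : IsHdCutTF' M (fun i => v (i + j₁)) (j₂ - j₁) :=
      isHdCutTF'_shift hM (by rw [Nat.add_sub_cancel' hge]; exact h₂)
    exact not_isHdCutTF'_of_isHdCutTF_zero hM hper' hrow' h0 (by omega) hb

/-! ### Shape FT: shape FT (`t + (−1,1) ∉ P`, `t + (3,0) ∈ Q`; `M = |P| + 2`) -/

/-- **Horizontal cut, forward reading**, shape FT (`t + (−1,1) ∉ P`, `t + (3,0) ∈ Q`; `M = |P| + 2`), of a `2M`-periodic site sequence at `j`,
base `s = v j = b = t − (1,0)`: the left block `v[j, j+M)` is `b, (P-arc), t = s+(1,0), s+(2,0), s+(3,0)`, the right block `v[j+M, j+2M)` is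
`s+(4,0), (Q-arc), w′ = s+(3,1), s+(2,1), s+(1,1), s+(0,1)` (`t + (3,1)` is not on the joined polygon); the left block lies strictly left of the
right block in every row. [cite: Hammond2015SAPJoining, Definition 4.3 (arXiv v5 p. 20: the junction plaquette; here a horizontal two-brick
cluster)] -/
def IsHdCutFT (M : ℕ) (v : ℕ → Site 2) (j : ℕ) : Prop :=
  (v (j + M - 3) 0 = v j 0 + 1 ∧ v (j + M - 3) 1 = v j 1) ∧
  (v (j + M - 2) 0 = v j 0 + 2 ∧ v (j + M - 2) 1 = v j 1) ∧
  (v (j + M - 1) 0 = v j 0 + 3 ∧ v (j + M - 1) 1 = v j 1) ∧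
  (v (j + M) 0 = v j 0 + 4 ∧ v (j + M) 1 = v j 1) ∧
  (v (j + 2 * M - 4) 0 = v j 0 + 3 ∧ v (j + 2 * M - 4) 1 = v j 1 + 1) ∧
  (v (j + 2 * M - 3) 0 = v j 0 + 2 ∧ v (j + 2 * M - 3) 1 = v j 1 + 1) ∧
  (v (j + 2 * M - 2) 0 = v j 0 + 1 ∧ v (j + 2 * M - 2) 1 = v j 1 + 1) ∧
  (v (j + 2 * M - 1) 0 = v j 0 ∧ v (j + 2 * M - 1) 1 = v j 1 + 1) ∧
  ∀ a b : ℕ, j ≤ a → a < j + M → j + M ≤ b → b < j + 2 * M → v a 1 = v b 1 → v a 0 < v b 0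

/-- **Horizontal cut, backward reading**, shape FT (`t + (−1,1) ∉ P`, `t + (3,0) ∈ Q`; `M = |P| + 2`), at `j`, base `r = v j = t + (−1,1)`: the
first block `v[j, j+M)` is `r, r+(1,0), r+(2,0), w′ = r+(3,0), (Q-arc), r+(4,−1)`, the second block `v[j+M, j+2M)` is `r+(3,−1), r+(2,−1), t =
r+(1,−1), (P-arc), b = r+(0,−1)`; the FIRST block lies strictly RIGHT of the second in every row. [cite: Hammond2015SAPJoining, Definition 4.3
(arXiv v5 p. 20)] -/
def IsHdCutFT' (M : ℕ) (v : ℕ → Site 2) (j : ℕ) : Prop :=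
  (v (j + 1) 0 = v j 0 + 1 ∧ v (j + 1) 1 = v j 1) ∧
  (v (j + 2) 0 = v j 0 + 2 ∧ v (j + 2) 1 = v j 1) ∧
  (v (j + 3) 0 = v j 0 + 3 ∧ v (j + 3) 1 = v j 1) ∧
  (v (j + M - 1) 0 = v j 0 + 4 ∧ v (j + M - 1) 1 + 1 = v j 1) ∧
  (v (j + M) 0 = v j 0 + 3 ∧ v (j + M) 1 + 1 = v j 1) ∧
  (v (j + M + 1) 0 = v j 0 + 2 ∧ v (j + M + 1) 1 + 1 = v j 1) ∧
  (v (j + M + 2) 0 = v j 0 + 1 ∧ v (j + M + 2) 1 + 1 = v j 1) ∧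
  (v (j + 2 * M - 1) 0 = v j 0 ∧ v (j + 2 * M - 1) 1 + 1 = v j 1) ∧
  ∀ a b : ℕ, j ≤ a → a < j + M → j + M ≤ b → b < j + 2 * M → v a 1 = v b 1 → v b 0 < v a 0

/-! #### Symmetries (FT) -/

/-- Re-indexing: a cut of `v` at `c + j` is a cut of `v (· + c)` at `j`. [cite: Hammond2015SAPJoining, Definition 4.3 (arXiv v5 p. 20)] -/
theorem isHdCutFT_shift {c j : ℕ} (hM : 5 ≤ M) (h : IsHdCutFT M v (c + j)) : IsHdCutFT M (fun i => v (i + c)) j := by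
  obtain ⟨⟨a0, a1⟩, ⟨b0, b1⟩, ⟨c0, c1⟩, ⟨d0, d1⟩, ⟨e0, e1⟩, ⟨f0, f1⟩, ⟨g0, g1⟩, ⟨h0, h1⟩, sep⟩ := h
  have E : ∀ k l : ℕ, l = c + k → v (k + c) = v l := fun k l hl => by rw [hl, Nat.add_comm]
  rw [IsHdCutFT, E (j + M - 3) (c + j + M - 3) (by omega), E (j + M - 2) (c + j + M - 2) (by omega), E (j + M - 1) (c + j + M - 1) (by omega),
    E (j + M) (c + j + M) (by omega), E (j + 2 * M - 4) (c + j + 2 * M - 4) (by omega), E (j + 2 * M - 3) (c + j + 2 * M - 3) (by omega),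
    E (j + 2 * M - 2) (c + j + 2 * M - 2) (by omega), E (j + 2 * M - 1) (c + j + 2 * M - 1) (by omega), E j (c + j) rfl]
  refine ⟨⟨a0, a1⟩, ⟨b0, b1⟩, ⟨c0, c1⟩, ⟨d0, d1⟩, ⟨e0, e1⟩, ⟨f0, f1⟩, ⟨g0, g1⟩, ⟨h0, h1⟩, fun a b ha1 ha2 hb1 hb2 hr => ?_⟩
  exact sep (a + c) (b + c) (by omega) (by omega) (by omega) (by omega) hr

/-- Periodicity: a cut at `j` is a cut at `j + 2M`. [cite: Hammond2015SAPJoining, Definition 4.3 (arXiv v5 p. 20)] -/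
theorem isHdCutFT_add_period {j : ℕ} (hM : 5 ≤ M) (hper : ∀ i, v (i + 2 * M) = v i) (h : IsHdCutFT M v j) :
    IsHdCutFT M v (j + 2 * M) := by
  obtain ⟨⟨a0, a1⟩, ⟨b0, b1⟩, ⟨c0, c1⟩, ⟨d0, d1⟩, ⟨e0, e1⟩, ⟨f0, f1⟩, ⟨g0, g1⟩, ⟨h0, h1⟩, sep⟩ := h
  have E : ∀ i k : ℕ, k = i + 2 * M → v k = v i := fun i k hk => by rw [hk, hper]
  rw [IsHdCutFT, E (j + M - 3) (j + 2 * M + M - 3) (by omega), E (j + M - 2) (j + 2 * M + M - 2) (by omega), E (j + M - 1) (j + 2 * M + M - 1) (by omega),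
    E (j + M) (j + 2 * M + M) (by omega), E (j + 2 * M - 4) (j + 2 * M + 2 * M - 4) (by omega), E (j + 2 * M - 3) (j + 2 * M + 2 * M - 3) (by omega),
    E (j + 2 * M - 2) (j + 2 * M + 2 * M - 2) (by omega), E (j + 2 * M - 1) (j + 2 * M + 2 * M - 1) (by omega), E j (j + 2 * M) rfl]
  refine ⟨⟨a0, a1⟩, ⟨b0, b1⟩, ⟨c0, c1⟩, ⟨d0, d1⟩, ⟨e0, e1⟩, ⟨f0, f1⟩, ⟨g0, g1⟩, ⟨h0, h1⟩, fun a b ha1 ha2 hb1 hb2 hr => ?_⟩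
  have ha := E (a - 2 * M) a (by omega)
  have hb := E (b - 2 * M) b (by omega)
  rw [ha, hb] at hr ⊢
  exact sep _ _ (by omega) (by omega) (by omega) (by omega) hr

/-- Re-indexing: a cut of `v` at `c + j` is a cut of `v (· + c)` at `j`. [cite: Hammond2015SAPJoining, Definition 4.3 (arXiv v5 p. 20)] -/
theorem isHdCutFT'_shift {c j : ℕ} (hM : 5 ≤ M) (h : IsHdCutFT' M v (c + j)) : IsHdCutFT' M (fun i => v (i + c)) j := by
  obtain ⟨⟨a0, a1⟩, ⟨b0, b1⟩, ⟨c0, c1⟩, ⟨d0, d1⟩, ⟨e0, e1⟩, ⟨f0, f1⟩, ⟨g0, g1⟩, ⟨h0, h1⟩, sep⟩ := h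
  have E : ∀ k l : ℕ, l = c + k → v (k + c) = v l := fun k l hl => by rw [hl, Nat.add_comm]
  rw [IsHdCutFT', E (j + 1) (c + j + 1) (by omega), E (j + 2) (c + j + 2) (by omega), E (j + 3) (c + j + 3) (by omega),
    E (j + M - 1) (c + j + M - 1) (by omega), E (j + M) (c + j + M) (by omega), E (j + M + 1) (c + j + M + 1) (by omega),
    E (j + M + 2) (c + j + M + 2) (by omega), E (j + 2 * M - 1) (c + j + 2 * M - 1) (by omega), E j (c + j) rfl]
  refine ⟨⟨a0, a1⟩, ⟨b0, b1⟩, ⟨c0, c1⟩, ⟨d0, d1⟩, ⟨e0, e1⟩, ⟨f0, f1⟩, ⟨g0, g1⟩, ⟨h0, h1⟩, fun a b ha1 ha2 hb1 hb2 hr => ?_⟩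
  exact sep (a + c) (b + c) (by omega) (by omega) (by omega) (by omega) hr

/-- Periodicity: a cut at `j` is a cut at `j + 2M`. [cite: Hammond2015SAPJoining, Definition 4.3 (arXiv v5 p. 20)] -/
theorem isHdCutFT'_add_period {j : ℕ} (hM : 5 ≤ M) (hper : ∀ i, v (i + 2 * M) = v i) (h : IsHdCutFT' M v j) :
    IsHdCutFT' M v (j + 2 * M) := by
  obtain ⟨⟨a0, a1⟩, ⟨b0, b1⟩, ⟨c0, c1⟩, ⟨d0, d1⟩, ⟨e0, e1⟩, ⟨f0, f1⟩, ⟨g0, g1⟩, ⟨h0, h1⟩, sep⟩ := h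
  have E : ∀ i k : ℕ, k = i + 2 * M → v k = v i := fun i k hk => by rw [hk, hper]
  rw [IsHdCutFT', E (j + 1) (j + 2 * M + 1) (by omega), E (j + 2) (j + 2 * M + 2) (by omega), E (j + 3) (j + 2 * M + 3) (by omega),
    E (j + M - 1) (j + 2 * M + M - 1) (by omega), E (j + M) (j + 2 * M + M) (by omega), E (j + M + 1) (j + 2 * M + M + 1) (by omega),
    E (j + M + 2) (j + 2 * M + M + 2) (by omega), E (j + 2 * M - 1) (j + 2 * M + 2 * M - 1) (by omega), E j (j + 2 * M) rfl]
  refine ⟨⟨a0, a1⟩, ⟨b0, b1⟩, ⟨c0, c1⟩, ⟨d0, d1⟩, ⟨e0, e1⟩, ⟨f0, f1⟩, ⟨g0, g1⟩, ⟨h0, h1⟩, fun a b ha1 ha2 hb1 hb2 hr => ?_⟩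
  have ha := E (a - 2 * M) a (by omega)
  have hb := E (b - 2 * M) b (by omega)
  rw [ha, hb] at hr ⊢
  exact sep _ _ (by omega) (by omega) (by omega) (by omega) hr

/-! #### Uniqueness of the forward cut (FT) -/

/-- Core case (FT): a forward cut at `0` excludes a forward cut at any `1 ≤ j ≤ M`. [cite: Hammond2015SAPJoining, §4.2 (arXiv v5 pp. 20–24: global
join plaquettes; here unique, for row-separated joins)] -/
theorem not_isHdCutFT_of_zero (hM : 5 ≤ M) (hper : ∀ i, v (i + 2 * M) = v i)
    (hrow : ∀ i, v (i + 1) 1 ≤ v i 1 + 1 ∧ v i 1 ≤ v (i + 1) 1 + 1) (hz : IsHdCutFT M v 0) {j : ℕ} (hone : 1 ≤ j) (hle : j ≤ M)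
    (hj : IsHdCutFT M v j) : False := by
  obtain ⟨⟨a0, a1⟩, ⟨b0, b1⟩, ⟨c0, c1⟩, ⟨d0, d1⟩, ⟨e0, e1⟩, ⟨f0, f1⟩, ⟨g0, g1⟩, ⟨h0, h1⟩, sep0⟩ := hz
  obtain ⟨⟨aj0, aj1⟩, ⟨bj0, bj1⟩, ⟨cj0, cj1⟩, ⟨dj0, dj1⟩, ⟨ej0, ej1⟩, ⟨fj0, fj1⟩, ⟨gj0, gj1⟩, ⟨hj0, hj1⟩, sepj⟩ := hj
  simp only [Nat.zero_add] at a0 a1 b0 b1 c0 c1 d0 d1 e0 e1 f0 f1 g0 g1 h0 h1 sep0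
  by_cases hjM : j = M
  · subst hjM
    rw [show j + j - 1 = 2 * j - 1 by omega] at cj0
    omega
  -- `1 ≤ j ≤ M − 1`: the arcs `A = [0, j−1] ⊆ L₀ ∩ R_j` and `B = [M, M+j−1] ⊆ R₀ ∩ L_j` both start in the base row
  exact sep_contra hrow (a₁ := 0) (a₂ := j - 1) (b₁ := M) (b₂ := M + j - 1) (by omega) (by omega) (v 0 1) (by omega) (by omega)
    (fun a b _ ha2 hb1 hb2 hr => sep0 a b (Nat.zero_le _) (by omega) hb1 (by omega) hr)
    (fun a b _ ha2 hb1 hb2 hr => by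
      have := sepj b (a + 2 * M) (by omega) (by omega) (by omega) (by omega) (by rw [hper]; exact hr.symm)
      rwa [hper] at this)

/-- **The forward horizontal cut of a merged honeycomb polygon is unique** (shape FT (`t + (−1,1) ∉ P`, `t + (3,0) ∈ Q`; `M = |P| + 2`)): for a
`2M`-periodic site sequence whose
rows move by at most one per step, two forward cuts `j₁, j₂ < 2M` coincide. [cite: Hammond2015SAPJoining, Definition 4.3 and §4.2 (arXiv v5 pp. 20–24)] [cite: Madras1995LatticeAnimalsExponent, §2] [cite: MadrasSlade1993, Theorem 3.2.3 proof (pp. 64–65)] -/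
theorem isHdCutFT_unique (hM : 5 ≤ M) (hper : ∀ i, v (i + 2 * M) = v i)
    (hrow : ∀ i, v (i + 1) 1 ≤ v i 1 + 1 ∧ v i 1 ≤ v (i + 1) 1 + 1) {j₁ j₂ : ℕ} (hj₁ : j₁ < 2 * M) (hj₂ : j₂ < 2 * M)
    (h₁ : IsHdCutFT M v j₁) (h₂ : IsHdCutFT M v j₂) : j₁ = j₂ := by
  by_contra hne
  have shift : ∀ a, (∀ i, (fun i => v (i + a)) (i + 2 * M) = (fun i => v (i + a)) i) ∧
      (∀ i, (fun i => v (i + a)) (i + 1) 1 ≤ (fun i => v (i + a)) i 1 + 1 ∧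
        (fun i => v (i + a)) i 1 ≤ (fun i => v (i + a)) (i + 1) 1 + 1) := by
    intro a
    refine ⟨fun i => ?_, fun i => ?_⟩
    · show v (i + 2 * M + a) = v (i + a)
      rw [show i + 2 * M + a = (i + a) + 2 * M by omega, hper]
    · show v (i + 1 + a) 1 ≤ v (i + a) 1 + 1 ∧ v (i + a) 1 ≤ v (i + 1 + a) 1 + 1
      rw [show i + 1 + a = (i + a) + 1 by omega]; exact hrow _
  have key : ∀ {a b : ℕ}, a < b → b ≤ a + M → IsHdCutFT M v a → IsHdCutFT M v b → False := by
    intro a b hab hbM ha hb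
    obtain ⟨hper', hrow'⟩ := shift a
    have h0 : IsHdCutFT M (fun i => v (i + a)) 0 := isHdCutFT_shift hM (by simpa using ha)
    have hb' : IsHdCutFT M (fun i => v (i + a)) (b - a) := isHdCutFT_shift hM (by rw [Nat.add_sub_cancel' hab.le]; exact hb)
    exact not_isHdCutFT_of_zero hM hper' hrow' h0 (by omega) (by omega) hb'
  rcases Nat.lt_or_gt_of_ne hne with h | h
  · by_cases hd : j₂ ≤ j₁ + M
    · exact key h hd h₁ h₂
    · exact key (show j₂ < j₁ + 2 * M by omega) (by omega) h₂ (isHdCutFT_add_period hM hper h₁)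
  · by_cases hd : j₁ ≤ j₂ + M
    · exact key h hd h₂ h₁
    · exact key (show j₁ < j₂ + 2 * M by omega) (by omega) h₁ (isHdCutFT_add_period hM hper h₂)

/-! #### No backward cut next to a forward cut (FT) -/

/-- Core case (FT): a forward cut at `0` excludes a backward cut at any `j < 2M`. [cite: Hammond2015SAPJoining, §4.2 (arXiv v5 pp. 20–24: global
join plaquettes; here unique, for row-separated joins)] -/
theorem not_isHdCutFT'_of_isHdCutFT_zero (hM : 5 ≤ M) (hper : ∀ i, v (i + 2 * M) = v i)
    (hrow : ∀ i, v (i + 1) 1 ≤ v i 1 + 1 ∧ v i 1 ≤ v (i + 1) 1 + 1) (hz : IsHdCutFT M v 0) {j : ℕ} (hj2 : j < 2 * M)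
    (hj : IsHdCutFT' M v j) : False := by
  obtain ⟨⟨a0, a1⟩, ⟨b0, b1⟩, ⟨c0, c1⟩, ⟨d0, d1⟩, ⟨e0, e1⟩, ⟨f0, f1⟩, ⟨g0, g1⟩, ⟨h0, h1⟩, sep0⟩ := hz
  obtain ⟨⟨aj0, aj1⟩, ⟨bj0, bj1⟩, ⟨cj0, cj1⟩, ⟨dj0, dj1⟩, ⟨ej0, ej1⟩, ⟨fj0, fj1⟩, ⟨gj0, gj1⟩, ⟨hj0, hj1⟩, sepj⟩ := hj
  simp only [Nat.zero_add] at a0 a1 b0 b1 c0 c1 d0 d1 e0 e1 f0 f1 g0 g1 h0 h1 sep0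
  rcases Nat.lt_or_ge j M with hlt | hge
  · -- `j ≤ M − 1`: the arcs `X = [j, M−1] ⊆ L₀ ∩ F_j` and `Y = [j+M, 2M−1] ⊆ R₀ ∩ S_j` overlap in rows
    have key : ∀ r : ℤ, ((v j 1 ≤ r ∧ r ≤ v (M - 1) 1) ∨ (v (M - 1) 1 ≤ r ∧ r ≤ v j 1)) →
        ((v (j + M) 1 ≤ r ∧ r ≤ v (2 * M - 1) 1) ∨ (v (2 * M - 1) 1 ≤ r ∧ r ≤ v (j + M) 1)) → False := fun r hrA hrB =>
      sep_contra hrow (a₁ := j) (a₂ := M - 1) (b₁ := j + M) (b₂ := 2 * M - 1) (by omega) (by omega) r hrA hrB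
        (fun a b ha1 ha2 hb1 hb2 hr => sep0 a b (Nat.zero_le _) (by omega) (by omega) (by omega) hr)
        (fun a b ha1 ha2 hb1 hb2 hr => sepj a b ha1 (by omega) hb1 (by omega) hr)
    by_cases hy : v j 1 ≤ v 0 1
    · exact key (v 0 1) (by omega) (by omega)
    · exact key (v j 1 - 1) (by omega) (by omega)
  by_cases e0 : j = M
  · subst e0
    rw [show j + j - 1 = 2 * j - 1 by omega] at dj0
    omega
  -- `j = M + k`, `1 ≤ k ≤ M − 1`: the arcs `A = [0, k−1]` and `B = [M, M+k−1]` both start in the base row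
  obtain ⟨k, rfl⟩ : ∃ k, j = M + k := ⟨j - M, by omega⟩
  have hk1 : 1 ≤ k := by omega
  have hkM : k ≤ M - 1 := by omega
  exact sep_contra hrow (a₁ := 0) (a₂ := k - 1) (b₁ := M) (b₂ := M + k - 1) (by omega) (by omega) (v 0 1) (by omega) (by omega)
    (fun a b _ ha2 hb1 hb2 hr => sep0 a b (Nat.zero_le _) (by omega) hb1 (by omega) hr)
    (fun a b _ ha2 hb1 hb2 hr => by
      have := sepj (a + 2 * M) (b + 2 * M) (by omega) (by omega) (by omega) (by omega) (by rw [hper, hper]; exact hr)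
      rwa [hper, hper] at this)

/-- **A forward and a backward horizontal cut never coexist** (shape FT (`t + (−1,1) ∉ P`, `t + (3,0) ∈ Q`; `M = |P| + 2`); `j₁, j₂ < 2M`). [cite:
Hammond2015SAPJoining, Definition 4.3 and §4.2 (arXiv v5 pp. 20–24)] [cite: Madras1995LatticeAnimalsExponent, §2] [cite: MadrasSlade1993, Theorem
3.2.3 proof (pp. 64–65)] -/
theorem not_isHdCutFT'_of_isHdCutFT (hM : 5 ≤ M) (hper : ∀ i, v (i + 2 * M) = v i)
    (hrow : ∀ i, v (i + 1) 1 ≤ v i 1 + 1 ∧ v i 1 ≤ v (i + 1) 1 + 1) {j₁ j₂ : ℕ} (hj₁ : j₁ < 2 * M) (hj₂ : j₂ < 2 * M)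
    (h₁ : IsHdCutFT M v j₁) (h₂ : IsHdCutFT' M v j₂) : False := by
  have hper' : ∀ i, (fun i => v (i + j₁)) (i + 2 * M) = (fun i => v (i + j₁)) i := fun i => by
    show v (i + 2 * M + j₁) = v (i + j₁)
    rw [show i + 2 * M + j₁ = (i + j₁) + 2 * M by omega, hper]
  have hrow' : ∀ i, (fun i => v (i + j₁)) (i + 1) 1 ≤ (fun i => v (i + j₁)) i 1 + 1 ∧
      (fun i => v (i + j₁)) i 1 ≤ (fun i => v (i + j₁)) (i + 1) 1 + 1 := fun i => by
    show v (i + 1 + j₁) 1 ≤ v (i + j₁) 1 + 1 ∧ v (i + j₁) 1 ≤ v (i + 1 + j₁) 1 + 1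
    rw [show i + 1 + j₁ = (i + j₁) + 1 by omega]; exact hrow _
  have h0 : IsHdCutFT M (fun i => v (i + j₁)) 0 := isHdCutFT_shift hM (by simpa using h₁)
  rcases Nat.lt_or_ge j₂ j₁ with hlt | hge
  · have h₂' := isHdCutFT'_add_period hM hper h₂
    have hb : IsHdCutFT' M (fun i => v (i + j₁)) (j₂ + 2 * M - j₁) :=
      isHdCutFT'_shift hM (by rw [show j₁ + (j₂ + 2 * M - j₁) = j₂ + 2 * M by omega]; exact h₂')
    exact not_isHdCutFT'_of_isHdCutFT_zero hM hper' hrow' h0 (by omega) hb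
  · have hb : IsHdCutFT' M (fun i => v (i + j₁)) (j₂ - j₁) :=
      isHdCutFT'_shift hM (by rw [Nat.add_sub_cancel' hge]; exact h₂)
    exact not_isHdCutFT'_of_isHdCutFT_zero hM hper' hrow' h0 (by omega) hb

/-! ### Shape TT: shape TT (`t + (−1,1) ∈ P`, `t + (3,0) ∈ Q`; `M = |P| + 1`) -/

/-- **Horizontal cut, forward reading**, shape TT (`t + (−1,1) ∈ P`, `t + (3,0) ∈ Q`; `M = |P| + 1`), of a `2M`-periodic site sequence at `j`,
base `s = v j = t + (−1,1)`: the left block `v[j, j+M)` is `s, (P-arc), t = s+(1,−1), s+(2,−1), s+(3,−1)`, the right block `v[j+M, j+2M)` is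
`s+(4,−1), (Q-arc), w′ = s+(3,0), s+(2,0), s+(1,0)`; the left block lies strictly left of the right block in every row. [cite:
Hammond2015SAPJoining, Definition 4.3 (arXiv v5 p. 20: the junction plaquette; here a horizontal two-brick cluster)] -/
def IsHdCutTT (M : ℕ) (v : ℕ → Site 2) (j : ℕ) : Prop :=
  (v (j + M - 3) 0 = v j 0 + 1 ∧ v (j + M - 3) 1 + 1 = v j 1) ∧
  (v (j + M - 2) 0 = v j 0 + 2 ∧ v (j + M - 2) 1 + 1 = v j 1) ∧
  (v (j + M - 1) 0 = v j 0 + 3 ∧ v (j + M - 1) 1 + 1 = v j 1) ∧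
  (v (j + M) 0 = v j 0 + 4 ∧ v (j + M) 1 + 1 = v j 1) ∧
  (v (j + 2 * M - 3) 0 = v j 0 + 3 ∧ v (j + 2 * M - 3) 1 = v j 1) ∧
  (v (j + 2 * M - 2) 0 = v j 0 + 2 ∧ v (j + 2 * M - 2) 1 = v j 1) ∧
  (v (j + 2 * M - 1) 0 = v j 0 + 1 ∧ v (j + 2 * M - 1) 1 = v j 1) ∧
  ∀ a b : ℕ, j ≤ a → a < j + M → j + M ≤ b → b < j + 2 * M → v a 1 = v b 1 → v a 0 < v b 0

/-- **Horizontal cut, backward reading**, shape TT (`t + (−1,1) ∈ P`, `t + (3,0) ∈ Q`; `M = |P| + 1`), at `j`, base `r = v j = t + (0,1)`: the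
first block `v[j, j+M)` is `r, r+(1,0), w′ = r+(2,0), (Q-arc), r+(3,−1)`, the second block `v[j+M, j+2M)` is `r+(2,−1), r+(1,−1), t = r+(0,−1),
(P-arc), r+(−1,0)`; the FIRST block lies strictly RIGHT of the second in every row. [cite: Hammond2015SAPJoining, Definition 4.3 (arXiv v5 p. 20)]
-/
def IsHdCutTT' (M : ℕ) (v : ℕ → Site 2) (j : ℕ) : Prop :=
  (v (j + 1) 0 = v j 0 + 1 ∧ v (j + 1) 1 = v j 1) ∧
  (v (j + 2) 0 = v j 0 + 2 ∧ v (j + 2) 1 = v j 1) ∧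
  (v (j + M - 1) 0 = v j 0 + 3 ∧ v (j + M - 1) 1 + 1 = v j 1) ∧
  (v (j + M) 0 = v j 0 + 2 ∧ v (j + M) 1 + 1 = v j 1) ∧
  (v (j + M + 1) 0 = v j 0 + 1 ∧ v (j + M + 1) 1 + 1 = v j 1) ∧
  (v (j + M + 2) 0 = v j 0 ∧ v (j + M + 2) 1 + 1 = v j 1) ∧
  (v (j + 2 * M - 1) 0 + 1 = v j 0 ∧ v (j + 2 * M - 1) 1 = v j 1) ∧
  ∀ a b : ℕ, j ≤ a → a < j + M → j + M ≤ b → b < j + 2 * M → v a 1 = v b 1 → v b 0 < v a 0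

/-! #### Symmetries (TT) -/

/-- Re-indexing: a cut of `v` at `c + j` is a cut of `v (· + c)` at `j`. [cite: Hammond2015SAPJoining, Definition 4.3 (arXiv v5 p. 20)] -/
theorem isHdCutTT_shift {c j : ℕ} (hM : 4 ≤ M) (h : IsHdCutTT M v (c + j)) : IsHdCutTT M (fun i => v (i + c)) j := by
  obtain ⟨⟨a0, a1⟩, ⟨b0, b1⟩, ⟨c0, c1⟩, ⟨d0, d1⟩, ⟨e0, e1⟩, ⟨f0, f1⟩, ⟨g0, g1⟩, sep⟩ := h
  have E : ∀ k l : ℕ, l = c + k → v (k + c) = v l := fun k l hl => by rw [hl, Nat.add_comm]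
  rw [IsHdCutTT, E (j + M - 3) (c + j + M - 3) (by omega), E (j + M - 2) (c + j + M - 2) (by omega), E (j + M - 1) (c + j + M - 1) (by omega),
    E (j + M) (c + j + M) (by omega), E (j + 2 * M - 3) (c + j + 2 * M - 3) (by omega), E (j + 2 * M - 2) (c + j + 2 * M - 2) (by omega),
    E (j + 2 * M - 1) (c + j + 2 * M - 1) (by omega), E j (c + j) rfl]
  refine ⟨⟨a0, a1⟩, ⟨b0, b1⟩, ⟨c0, c1⟩, ⟨d0, d1⟩, ⟨e0, e1⟩, ⟨f0, f1⟩, ⟨g0, g1⟩, fun a b ha1 ha2 hb1 hb2 hr => ?_⟩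
  exact sep (a + c) (b + c) (by omega) (by omega) (by omega) (by omega) hr

/-- Periodicity: a cut at `j` is a cut at `j + 2M`. [cite: Hammond2015SAPJoining, Definition 4.3 (arXiv v5 p. 20)] -/
theorem isHdCutTT_add_period {j : ℕ} (hM : 4 ≤ M) (hper : ∀ i, v (i + 2 * M) = v i) (h : IsHdCutTT M v j) :
    IsHdCutTT M v (j + 2 * M) := by
  obtain ⟨⟨a0, a1⟩, ⟨b0, b1⟩, ⟨c0, c1⟩, ⟨d0, d1⟩, ⟨e0, e1⟩, ⟨f0, f1⟩, ⟨g0, g1⟩, sep⟩ := h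
  have E : ∀ i k : ℕ, k = i + 2 * M → v k = v i := fun i k hk => by rw [hk, hper]
  rw [IsHdCutTT, E (j + M - 3) (j + 2 * M + M - 3) (by omega), E (j + M - 2) (j + 2 * M + M - 2) (by omega), E (j + M - 1) (j + 2 * M + M - 1) (by omega),
    E (j + M) (j + 2 * M + M) (by omega), E (j + 2 * M - 3) (j + 2 * M + 2 * M - 3) (by omega), E (j + 2 * M - 2) (j + 2 * M + 2 * M - 2) (by omega),
    E (j + 2 * M - 1) (j + 2 * M + 2 * M - 1) (by omega), E j (j + 2 * M) rfl]
  refine ⟨⟨a0, a1⟩, ⟨b0, b1⟩, ⟨c0, c1⟩, ⟨d0, d1⟩, ⟨e0, e1⟩, ⟨f0, f1⟩, ⟨g0, g1⟩, fun a b ha1 ha2 hb1 hb2 hr => ?_⟩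
  have ha := E (a - 2 * M) a (by omega)
  have hb := E (b - 2 * M) b (by omega)
  rw [ha, hb] at hr ⊢
  exact sep _ _ (by omega) (by omega) (by omega) (by omega) hr

/-- Re-indexing: a cut of `v` at `c + j` is a cut of `v (· + c)` at `j`. [cite: Hammond2015SAPJoining, Definition 4.3 (arXiv v5 p. 20)] -/
theorem isHdCutTT'_shift {c j : ℕ} (hM : 4 ≤ M) (h : IsHdCutTT' M v (c + j)) : IsHdCutTT' M (fun i => v (i + c)) j := by
  obtain ⟨⟨a0, a1⟩, ⟨b0, b1⟩, ⟨c0, c1⟩, ⟨d0, d1⟩, ⟨e0, e1⟩, ⟨f0, f1⟩, ⟨g0, g1⟩, sep⟩ := h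
  have E : ∀ k l : ℕ, l = c + k → v (k + c) = v l := fun k l hl => by rw [hl, Nat.add_comm]
  rw [IsHdCutTT', E (j + 1) (c + j + 1) (by omega), E (j + 2) (c + j + 2) (by omega), E (j + M - 1) (c + j + M - 1) (by omega),
    E (j + M) (c + j + M) (by omega), E (j + M + 1) (c + j + M + 1) (by omega), E (j + M + 2) (c + j + M + 2) (by omega),
    E (j + 2 * M - 1) (c + j + 2 * M - 1) (by omega), E j (c + j) rfl]
  refine ⟨⟨a0, a1⟩, ⟨b0, b1⟩, ⟨c0, c1⟩, ⟨d0, d1⟩, ⟨e0, e1⟩, ⟨f0, f1⟩, ⟨g0, g1⟩, fun a b ha1 ha2 hb1 hb2 hr => ?_⟩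
  exact sep (a + c) (b + c) (by omega) (by omega) (by omega) (by omega) hr

/-- Periodicity: a cut at `j` is a cut at `j + 2M`. [cite: Hammond2015SAPJoining, Definition 4.3 (arXiv v5 p. 20)] -/
theorem isHdCutTT'_add_period {j : ℕ} (hM : 4 ≤ M) (hper : ∀ i, v (i + 2 * M) = v i) (h : IsHdCutTT' M v j) :
    IsHdCutTT' M v (j + 2 * M) := by
  obtain ⟨⟨a0, a1⟩, ⟨b0, b1⟩, ⟨c0, c1⟩, ⟨d0, d1⟩, ⟨e0, e1⟩, ⟨f0, f1⟩, ⟨g0, g1⟩, sep⟩ := h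
  have E : ∀ i k : ℕ, k = i + 2 * M → v k = v i := fun i k hk => by rw [hk, hper]
  rw [IsHdCutTT', E (j + 1) (j + 2 * M + 1) (by omega), E (j + 2) (j + 2 * M + 2) (by omega), E (j + M - 1) (j + 2 * M + M - 1) (by omega),
    E (j + M) (j + 2 * M + M) (by omega), E (j + M + 1) (j + 2 * M + M + 1) (by omega), E (j + M + 2) (j + 2 * M + M + 2) (by omega),
    E (j + 2 * M - 1) (j + 2 * M + 2 * M - 1) (by omega), E j (j + 2 * M) rfl]
  refine ⟨⟨a0, a1⟩, ⟨b0, b1⟩, ⟨c0, c1⟩, ⟨d0, d1⟩, ⟨e0, e1⟩, ⟨f0, f1⟩, ⟨g0, g1⟩, fun a b ha1 ha2 hb1 hb2 hr => ?_⟩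
  have ha := E (a - 2 * M) a (by omega)
  have hb := E (b - 2 * M) b (by omega)
  rw [ha, hb] at hr ⊢
  exact sep _ _ (by omega) (by omega) (by omega) (by omega) hr

/-! #### Uniqueness of the forward cut (TT) -/

/-- Core case (TT): a forward cut at `0` excludes a forward cut at any `1 ≤ j ≤ M`. [cite: Hammond2015SAPJoining, §4.2 (arXiv v5 pp. 20–24: global
join plaquettes; here unique, for row-separated joins)] -/
theorem not_isHdCutTT_of_zero (hM : 4 ≤ M) (hper : ∀ i, v (i + 2 * M) = v i)
    (hrow : ∀ i, v (i + 1) 1 ≤ v i 1 + 1 ∧ v i 1 ≤ v (i + 1) 1 + 1) (hz : IsHdCutTT M v 0) {j : ℕ} (hone : 1 ≤ j) (hle : j ≤ M)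
    (hj : IsHdCutTT M v j) : False := by
  obtain ⟨⟨a0, a1⟩, ⟨b0, b1⟩, ⟨c0, c1⟩, ⟨d0, d1⟩, ⟨e0, e1⟩, ⟨f0, f1⟩, ⟨g0, g1⟩, sep0⟩ := hz
  obtain ⟨⟨aj0, aj1⟩, ⟨bj0, bj1⟩, ⟨cj0, cj1⟩, ⟨dj0, dj1⟩, ⟨ej0, ej1⟩, ⟨fj0, fj1⟩, ⟨gj0, gj1⟩, sepj⟩ := hj
  simp only [Nat.zero_add] at a0 a1 b0 b1 c0 c1 d0 d1 e0 e1 f0 f1 g0 g1 sep0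
  by_cases hjM : j = M
  · subst hjM
    rw [show j + j - 1 = 2 * j - 1 by omega] at cj0
    omega
  by_cases hj1 : j = 1
  · subst hj1
    rw [show 1 + 2 * M - 1 = 0 + 2 * M by omega, hper] at gj0
    rw [show 1 + M - 1 = M by omega] at cj0
    omega
  -- `2 ≤ j ≤ M − 1`
  have hj2 : 2 ≤ j := by omega
  have Rj1 : v (j - 1) 1 = v j 1 := by rw [show j + 2 * M - 1 = (j - 1) + 2 * M by omega, hper] at gj1; exact gj1
  have Rj2 : v (j - 2) 0 = v j 0 + 2 ∧ v (j - 2) 1 = v j 1 := by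
    rw [show j + 2 * M - 2 = (j - 2) + 2 * M by omega, hper] at fj0 fj1; exact ⟨fj0, fj1⟩
  by_cases hy : v j 1 = v 0 1
  · -- equal base rows: `(3,0)₀ = v M` and `(3,0)_j = v (j+M)` share a row, as do `(1,1)_j = v (j−2)` and `(0,1)₀ = v (2M−1)`
    have h1 := sepj M (j + M) (by omega) (by omega) le_rfl (by omega) (by omega)
    have h2 := sep0 (j - 2) (2 * M - 1) (Nat.zero_le _) (by omega) (by omega) (by omega) (by omega)
    omega
  -- different base rows: the arcs `A = [0, j−1]` (rows `y₀ … y_j`) and `B = [M, M+j−1]` (rows `y₀ − 1 … y_j − 1`) overlap in rows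
  rw [show j + M - 1 = M + j - 1 by omega] at cj1
  have key : ∀ r : ℤ, ((v 0 1 ≤ r ∧ r ≤ v (j - 1) 1) ∨ (v (j - 1) 1 ≤ r ∧ r ≤ v 0 1)) →
      ((v M 1 ≤ r ∧ r ≤ v (M + j - 1) 1) ∨ (v (M + j - 1) 1 ≤ r ∧ r ≤ v M 1)) → False := fun r hrA hrB =>
    sep_contra hrow (a₁ := 0) (a₂ := j - 1) (b₁ := M) (b₂ := M + j - 1) (by omega) (by omega) r hrA hrB
      (fun a b _ ha2 hb1 hb2 hr => sep0 a b (Nat.zero_le _) (by omega) hb1 (by omega) hr)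
      (fun a b _ ha2 hb1 hb2 hr => by
        have := sepj b (a + 2 * M) (by omega) (by omega) (by omega) (by omega) (by rw [hper]; exact hr.symm)
        rwa [hper] at this)
  by_cases hy' : v j 1 < v 0 1
  · exact key (v j 1) (by omega) (by omega)
  · exact key (v 0 1) (by omega) (by omega)

/-- **The forward horizontal cut of a merged honeycomb polygon is unique** (shape TT (`t + (−1,1) ∈ P`, `t + (3,0) ∈ Q`; `M = |P| + 1`)): for a
`2M`-periodic site sequence whose
rows move by at most one per step, two forward cuts `j₁, j₂ < 2M` coincide. [cite: Hammond2015SAPJoining, Definition 4.3 and §4.2 (arXiv v5 pp. 20–24)] [cite: Madras1995LatticeAnimalsExponent, §2] [cite: MadrasSlade1993, Theorem 3.2.3 proof (pp. 64–65)] -/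
theorem isHdCutTT_unique (hM : 4 ≤ M) (hper : ∀ i, v (i + 2 * M) = v i)
    (hrow : ∀ i, v (i + 1) 1 ≤ v i 1 + 1 ∧ v i 1 ≤ v (i + 1) 1 + 1) {j₁ j₂ : ℕ} (hj₁ : j₁ < 2 * M) (hj₂ : j₂ < 2 * M)
    (h₁ : IsHdCutTT M v j₁) (h₂ : IsHdCutTT M v j₂) : j₁ = j₂ := by
  by_contra hne
  have shift : ∀ a, (∀ i, (fun i => v (i + a)) (i + 2 * M) = (fun i => v (i + a)) i) ∧
      (∀ i, (fun i => v (i + a)) (i + 1) 1 ≤ (fun i => v (i + a)) i 1 + 1 ∧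
        (fun i => v (i + a)) i 1 ≤ (fun i => v (i + a)) (i + 1) 1 + 1) := by
    intro a
    refine ⟨fun i => ?_, fun i => ?_⟩
    · show v (i + 2 * M + a) = v (i + a)
      rw [show i + 2 * M + a = (i + a) + 2 * M by omega, hper]
    · show v (i + 1 + a) 1 ≤ v (i + a) 1 + 1 ∧ v (i + a) 1 ≤ v (i + 1 + a) 1 + 1
      rw [show i + 1 + a = (i + a) + 1 by omega]; exact hrow _
  have key : ∀ {a b : ℕ}, a < b → b ≤ a + M → IsHdCutTT M v a → IsHdCutTT M v b → False := by
    intro a b hab hbM ha hb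
    obtain ⟨hper', hrow'⟩ := shift a
    have h0 : IsHdCutTT M (fun i => v (i + a)) 0 := isHdCutTT_shift hM (by simpa using ha)
    have hb' : IsHdCutTT M (fun i => v (i + a)) (b - a) := isHdCutTT_shift hM (by rw [Nat.add_sub_cancel' hab.le]; exact hb)
    exact not_isHdCutTT_of_zero hM hper' hrow' h0 (by omega) (by omega) hb'
  rcases Nat.lt_or_gt_of_ne hne with h | h
  · by_cases hd : j₂ ≤ j₁ + M
    · exact key h hd h₁ h₂
    · exact key (show j₂ < j₁ + 2 * M by omega) (by omega) h₂ (isHdCutTT_add_period hM hper h₁)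
  · by_cases hd : j₁ ≤ j₂ + M
    · exact key h hd h₂ h₁
    · exact key (show j₁ < j₂ + 2 * M by omega) (by omega) h₁ (isHdCutTT_add_period hM hper h₂)

/-! #### No backward cut next to a forward cut (TT) -/

/-- Core case (TT): a forward cut at `0` excludes a backward cut at any `j < 2M`. [cite: Hammond2015SAPJoining, §4.2 (arXiv v5 pp. 20–24: global
join plaquettes; here unique, for row-separated joins)] -/
theorem not_isHdCutTT'_of_isHdCutTT_zero (hM : 4 ≤ M) (hper : ∀ i, v (i + 2 * M) = v i)
    (hrow : ∀ i, v (i + 1) 1 ≤ v i 1 + 1 ∧ v i 1 ≤ v (i + 1) 1 + 1) (hz : IsHdCutTT M v 0) {j : ℕ} (hj2 : j < 2 * M)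
    (hj : IsHdCutTT' M v j) : False := by
  obtain ⟨⟨a0, a1⟩, ⟨b0, b1⟩, ⟨c0, c1⟩, ⟨d0, d1⟩, ⟨e0, e1⟩, ⟨f0, f1⟩, ⟨g0, g1⟩, sep0⟩ := hz
  obtain ⟨⟨aj0, aj1⟩, ⟨bj0, bj1⟩, ⟨cj0, cj1⟩, ⟨dj0, dj1⟩, ⟨ej0, ej1⟩, ⟨fj0, fj1⟩, ⟨gj0, gj1⟩, sepj⟩ := hj
  simp only [Nat.zero_add] at a0 a1 b0 b1 c0 c1 d0 d1 e0 e1 f0 f1 g0 g1 sep0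
  rcases Nat.lt_or_ge j M with hlt | hge
  · -- `j ≤ M − 1`: the arcs `X = [j, M−1] ⊆ L₀ ∩ F_j` and `Y = [j+M, 2M−1] ⊆ R₀ ∩ S_j` overlap in rows
    have key : ∀ r : ℤ, ((v j 1 ≤ r ∧ r ≤ v (M - 1) 1) ∨ (v (M - 1) 1 ≤ r ∧ r ≤ v j 1)) →
        ((v (j + M) 1 ≤ r ∧ r ≤ v (2 * M - 1) 1) ∨ (v (2 * M - 1) 1 ≤ r ∧ r ≤ v (j + M) 1)) → False := fun r hrA hrB =>
      sep_contra hrow (a₁ := j) (a₂ := M - 1) (b₁ := j + M) (b₂ := 2 * M - 1) (by omega) (by omega) r hrA hrB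
        (fun a b ha1 ha2 hb1 hb2 hr => sep0 a b (Nat.zero_le _) (by omega) (by omega) (by omega) hr)
        (fun a b ha1 ha2 hb1 hb2 hr => sepj a b ha1 (by omega) hb1 (by omega) hr)
    by_cases hy : v j 1 ≤ v 0 1
    · exact key (v j 1) (by omega) (by omega)
    · exact key (v 0 1) (by omega) (by omega)
  by_cases e0 : j = M
  · subst e0
    rw [show j + j - 1 = 2 * j - 1 by omega] at cj0
    omega
  by_cases e1 : j = M + 1
  · subst e1
    rw [show M + 1 + M - 1 = 0 + 2 * M by omega, hper] at cj0
    rw [show M + 1 + 2 * M - 1 = M + 2 * M by omega, hper] at gj0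
    omega
  -- `j = M + k`, `2 ≤ k ≤ M − 1`: the arcs `A = [0, k−1]` (rows `y₀ … y' − 1`) and `B = [M, M+k−1]` (rows `y₀ − 1 … y'`) overlap in rows
  obtain ⟨k, rfl⟩ : ∃ k, j = M + k := ⟨j - M, by omega⟩
  have hk2 : 2 ≤ k := by omega
  have hkM : k ≤ M - 1 := by omega
  rw [show M + k + M - 1 = (k - 1) + 2 * M by omega, hper] at cj1
  rw [show M + k + 2 * M - 1 = (M + k - 1) + 2 * M by omega, hper] at gj1
  have key : ∀ r : ℤ, ((v 0 1 ≤ r ∧ r ≤ v (k - 1) 1) ∨ (v (k - 1) 1 ≤ r ∧ r ≤ v 0 1)) →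
      ((v M 1 ≤ r ∧ r ≤ v (M + k - 1) 1) ∨ (v (M + k - 1) 1 ≤ r ∧ r ≤ v M 1)) → False := fun r hrA hrB =>
    sep_contra hrow (a₁ := 0) (a₂ := k - 1) (b₁ := M) (b₂ := M + k - 1) (by omega) (by omega) r hrA hrB
      (fun a b _ ha2 hb1 hb2 hr => sep0 a b (Nat.zero_le _) (by omega) hb1 (by omega) hr)
      (fun a b _ ha2 hb1 hb2 hr => by
        have := sepj (a + 2 * M) (b + 2 * M) (by omega) (by omega) (by omega) (by omega) (by rw [hper, hper]; exact hr)
        rwa [hper, hper] at this)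
  by_cases hy : v 0 1 ≤ v (M + k) 1
  · exact key (v 0 1) (by omega) (by omega)
  · exact key (v (M + k) 1) (by omega) (by omega)

/-- **A forward and a backward horizontal cut never coexist** (shape TT (`t + (−1,1) ∈ P`, `t + (3,0) ∈ Q`; `M = |P| + 1`); `j₁, j₂ < 2M`). [cite:
Hammond2015SAPJoining, Definition 4.3 and §4.2 (arXiv v5 pp. 20–24)] [cite: Madras1995LatticeAnimalsExponent, §2] [cite: MadrasSlade1993, Theorem
3.2.3 proof (pp. 64–65)] -/
theorem not_isHdCutTT'_of_isHdCutTT (hM : 4 ≤ M) (hper : ∀ i, v (i + 2 * M) = v i)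
    (hrow : ∀ i, v (i + 1) 1 ≤ v i 1 + 1 ∧ v i 1 ≤ v (i + 1) 1 + 1) {j₁ j₂ : ℕ} (hj₁ : j₁ < 2 * M) (hj₂ : j₂ < 2 * M)
    (h₁ : IsHdCutTT M v j₁) (h₂ : IsHdCutTT' M v j₂) : False := by
  have hper' : ∀ i, (fun i => v (i + j₁)) (i + 2 * M) = (fun i => v (i + j₁)) i := fun i => by
    show v (i + 2 * M + j₁) = v (i + j₁)
    rw [show i + 2 * M + j₁ = (i + j₁) + 2 * M by omega, hper]
  have hrow' : ∀ i, (fun i => v (i + j₁)) (i + 1) 1 ≤ (fun i => v (i + j₁)) i 1 + 1 ∧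
      (fun i => v (i + j₁)) i 1 ≤ (fun i => v (i + j₁)) (i + 1) 1 + 1 := fun i => by
    show v (i + 1 + j₁) 1 ≤ v (i + j₁) 1 + 1 ∧ v (i + j₁) 1 ≤ v (i + 1 + j₁) 1 + 1
    rw [show i + 1 + j₁ = (i + j₁) + 1 by omega]; exact hrow _
  have h0 : IsHdCutTT M (fun i => v (i + j₁)) 0 := isHdCutTT_shift hM (by simpa using h₁)
  rcases Nat.lt_or_ge j₂ j₁ with hlt | hge
  · have h₂' := isHdCutTT'_add_period hM hper h₂
    have hb : IsHdCutTT' M (fun i => v (i + j₁)) (j₂ + 2 * M - j₁) :=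
      isHdCutTT'_shift hM (by rw [show j₁ + (j₂ + 2 * M - j₁) = j₂ + 2 * M by omega]; exact h₂')
    exact not_isHdCutTT'_of_isHdCutTT_zero hM hper' hrow' h0 (by omega) hb
  · have hb : IsHdCutTT' M (fun i => v (i + j₁)) (j₂ - j₁) :=
      isHdCutTT'_shift hM (by rw [Nat.add_sub_cancel' hge]; exact h₂)
    exact not_isHdCutTT'_of_isHdCutTT_zero hM hper' hrow' h0 (by omega) hb


end HexBW

end Literature.Probability.RandomPlanarGeometry.SAW
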